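import Mathlib
import Summits.CriticalPhenomena.CardyFormulaZ2.Theses.CardyRotToConf

/-!
# `CardyRotToConfLimitGlue` — the limit-glue step of route CardyRotToConf

Item stmt-CriticalPhenomena-8602 (support). If the interfaces `X δ` are eventually
a.e.-measurable and converge in law (`TendstoLaw`, bounded continuous test functions) to the
identity random variable under a measure `ν` on `CurveClass ℂ`, and `ν` is a chordal SLE₆ law of
the Dobrushin domain `D` (`IsSLELaw 6 D ν`, i.e. `ν = preWienerMeasure.map Γ` for an SLE₆ random
curve `Γ`), then `X` converges in law to chordal SLE₆ in `D` (`ConvergesInLawToSLE 6 D X P`).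
Proof: unpack `IsSLELaw` and change the limit variable with `MeasureTheory.integral_map`
(Billingsley 1999 §1.2; Lawler 2005 §6.3).
-/

namespace Summit.CriticalPhenomena.CardyFormulaZ2.Theorems

open MeasureTheory

/-- **Limit glue** (item stmt-CriticalPhenomena-8602, route CardyRotToConf): convergence in law of
`X δ` to the identity under an SLE₆ law `ν` of `D`, together with eventual a.e.-measurability of
`X δ`, gives `ConvergesInLawToSLE 6 D X P` for the bond-percolation measure `P`. Unpack
`IsSLELaw 6 D ν` as `ν = preWienerMeasure.map Γ` with `Γ` an SLE₆ random curve and rewrite the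
limit of each test-function integral by the change-of-variables formula `integral_map`. -/
theorem cardyRotToConfLimitGlue_proof :
    Summit.CriticalPhenomena.CardyFormulaZ2.Theses.CardyRotToConf.CardyRotToConfLimitGlue := by
  unfold Summit.CriticalPhenomena.CardyFormulaZ2.Theses.CardyRotToConf.CardyRotToConfLimitGlue
  intro D X ν hmeas hconv hSLE
  obtain ⟨Γ, hΓ, hν⟩ := hSLE
  refine ⟨Γ, hΓ, hmeas, fun f => ?_⟩
  have h := hconv f
  dsimp only [id] at h
  rw [hν, MeasureTheory.integral_map hΓ.1 f.continuous.aestronglyMeasurable] at h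
  exact h

end Summit.CriticalPhenomena.CardyFormulaZ2.Theorems
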